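import Literature.AlgebraicGeometry.HodgeTheory.BettiHodgeConjectureProductsTwoTopDegreeHomConditions
import Literature.AlgebraicGeometry.HodgeTheory.BettiKunnethHodgeClassesAlgebraicClasses
import HarnessLib

/-!
# The two top-degree conditions `Hom_HS(H^{mₒ}Y, H^{nₒ}Z((nₒ − mₒ)/2)) = 0`, `dim Hom_HS(H^{2μ}Y, H^{2ν}Z(ν − μ)) ≤ ρ_μ(Y)ρ_ν(Z)` hold IFF `Y × Z` has NO EXCEPTIONAL HODGE CLASSES:
# `dim_ℚ Hdgᵖ(H^{2p}(Y × Z)) = Σ_{a+b=p} ρ_a(Y) ρ_b(Z)` in every degree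
# (Voisin I Cor. 6.26, Rem. 6.27, Lemma 7.23, Lemma 7.26, §11.3.3 Thm. 11.38–11.40, Lemma 11.41, p. 287; Arapura 2001 Lemma 9; Hulek–Laface Prop. 2.2; Deligne Hodge II 2.1.13)

Family `hodge`, lane `lit-hodgefound` (Track 2 foundations library; Layers A1/A4), layer `Literature/AlgebraicGeometry/HodgeTheory`.  THEOREMS ONLY (no definition, no named fact,
no instance, no notation; D-0026 net debt `0`).  Prover seat `lit-hodgefound-p21` (generation 39, row g39-#7), sequel of the seat's g39-#1/#2 (block counts along the Lefschetz decomposition),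
g39-#4 (the top odd `Hom_HS` governs the odd primitive blocks), g39-#5/#6 `BettiHodgeConjectureProductsTwoTopDegreeHomConditions` (the top even count governs the even primitive counts;
`HC(Y × Z)` ⟸ `HC(Y)`, `HC(Z)` and the two top-degree conditions) and g27-#1 `BettiKunnethHodgeClassesAlgebraicClasses` (`HC(Y × Z)` ⟸ `HC(Y)`, `HC(Z)` and
`dim Hdgᵖ(H^{2p}(Y × Z)) = Σ_{a+b=p} ρ_a(Y)ρ_b(Z)` for all `p` — no exceptional Hodge classes).

THE MATHEMATICS.  Let `Y`, `Z` be smooth projective of dimensions `m`, `n ≥ 1`; `mₒ`, `2μ ∈ {m − 1, m}` the top odd / even degrees, `nₒ`, `2ν` likewise.  By Künneth (Thm. 11.38/11.40)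
`dim Hdgᵖ(H^{2p}(Y × Z)) = Σ_{i+j=2p} dim Hdgᵖ(Hⁱ(Y) ⊗ Hʲ(Z))`, and by Lemma 11.41 each piece counts morphisms of Hodge structures, `dim Hdgᵖ(HⁱY ⊗ HʲZ) = dim Hom_HS(HⁱY, HʲZ((j − i)/2))`,
which (Cor. 6.26, Rem. 6.27, Lemma 7.23) is the sum over the admissible Lefschetz blocks of `dim Hom_HS(Pⁱ'(Y), Pʲ'(Z)(·))`, `i' ≡ i`, `j' ≡ j (mod 2)`, `i' ≤ m`, `j' ≤ n` — in ANY degree,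
also above the middle.  The odd blocks all occur in `Hom_HS(H^{mₒ}Y, H^{nₒ}Z)` and the even ones in `Hom_HS(H^{2μ}Y, H^{2ν}Z)`, each even block being `≥ ρ₀ᵃ(Y)ρ₀ᵇ(Z)` (Hulek–Laface
Prop. 2.2 on the polarised primitive parts).  Hence: (§1) `Hom_HS(H^{mₒ}Y, H^{nₒ}Z((nₒ − mₒ)/2)) = 0` ⟹ `Hom_HS(HⁱY, HʲZ(s)) = 0` for ALL odd `i`, `j` ⟹ the odd Künneth pieces carry no Hodge
class; (§2) `dim Hom_HS(H^{2μ}Y, H^{2ν}Z(ν − μ)) ≤ ρ_μρ_ν` ⟹ `dim Hom_HS(H^{2a}Y, H^{2b}Z(b − a)) = ρ_a(Y)ρ_b(Z)` for ALL `a`, `b` ⟹ every even piece carries exactly the products of Hodge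
classes; (§3) so the two conditions give `dim Hdgᵖ(H^{2p}(Y × Z)) = Σ_{a+b=p} ρ_aρ_b` for every `p`.  Conversely (§4) the latter sum is always `≤` the former termwise (odd pieces `≥ 0`, even
pieces `≥ ρ_aρ_b`, Thm. 11.38), so equality of the totals forces every odd piece to be Hodge-free and every even piece to be saturated — in particular the two top-degree conditions (§5:
the equivalence).  Thus g39-#5's criterion is g27-#1's «no exceptional classes» criterion with its hypothesis compressed into two top-degree conditions, and this family of criteria never
reaches a product carrying an honest exceptional Hodge class (e.g. a square `X × X` with `Hⁱ(X)` not of Tate type: the graph of the identity).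

WHAT IS PROVED (all binders explicit; `H = BettiUniverse.hodge`, `ρ_q(HⁱX) = dim_ℚ Hdg^q(Hⁱ(X))`).
* §1 `BettiUniverse.subsingleton_hom_hodge_tateTwist_odd_of_top` (top odd `Hom_HS = 0` ⟹ `Hom_HS(HⁱY, HʲZ(s)) = 0`, `i` odd, any degrees),
  `BettiUniverse.finrank_hodgeClasses_tensor_hodge_eq_zero_of_odd_of_top` (⟹ `dim Hdgᵖ(HⁱY ⊗ HʲZ) = 0`, `i + j = 2p`, `i` odd).
* §2 `BettiUniverse.finrank_hom_primitiveHodge_eq_mul_of_top` (blockwise), `BettiUniverse.finrank_hom_hodge_tateTwist_even_eq_mul_of_top` (`dim Hom_HS(H^{2a}Y, H^{2b}Z(b − a)) = ρ_aρ_b`, all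
  `a`, `b`), `BettiUniverse.finrank_hodgeClasses_tensor_hodge_even_eq_mul_of_top` (`dim Hdgᵖ(H^{2a}Y ⊗ H^{2b}Z) = ρ_aρ_b`, `a + b = p`).
* §3 `BettiUniverse.finrank_hodgeClasses_hodge_tensor_eq_sum_mul_of_top` (⟹ the global count in every degree).
* §4 `BettiUniverse.finrank_hodgeClasses_tensor_hodge_eq_zero_of_forall_eq_sum_mul` / `…subsingleton_hom_hodge_tateTwist_of_forall_eq_sum_mul` (global count ⟹ odd pieces Hodge-free),
  `BettiUniverse.finrank_hom_hodge_tateTwist_eq_mul_of_forall_eq_sum_mul` (⟹ even pieces saturated).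
* §5 `BettiUniverse.forall_finrank_hodgeClasses_eq_sum_mul_iff_top` (THE EQUIVALENCE; with §3, g39-#5's criterion factors through g27-#1's `…_of_forall_finrank_eq_sum`).

THE PRINTS.  C. Voisin (2002) [VoisinHodgeI2002] §6.2.3 Thm. 6.25, Cor. 6.26, Rem. 6.27 (held text p0125–p0126); §7.1.2 Lemma 7.26 (p0148); §7.3.1 Lemma 7.23 (p0147); §11.3.3 Thm. 11.38,
Def. 11.39, Thm. 11.40, Lemma 11.41 (p0236), p. 287.  D. Arapura (2001) [Arapura2001HodgeCyclesModuli] Lemma 9, Cor. 10 (as vendored by g27-#1).  K. Hulek, R. Laface (2019)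
[HulekLaface2019PicardNumbersAV] §2.1 Prop. 2.2.  P. Deligne (1971) [DeligneHodgeII1971] 2.1, 2.1.13–2.1.15.  The equivalence is bookkeeping on these prints (no new mathematics is claimed).

## References
* [VoisinHodgeI2002] C. Voisin, *Hodge Theory and Complex Algebraic Geometry I* (2002) — §6.2.3 Thm. 6.25, Cor. 6.26, Rem. 6.27; §7.1.2 Lemma 7.26; §7.3.1 Lemma 7.23; §11.3.3
  Thm. 11.38–11.40, Lemma 11.41, p. 287.
* [Arapura2001HodgeCyclesModuli] D. Arapura, *Hodge cycles on some moduli spaces* (2001) — Lemma 9, Cor. 10.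
* [HulekLaface2019PicardNumbersAV] K. Hulek, R. Laface, *On the Picard numbers of abelian varieties* (2019) — §2.1 Prop. 2.2.
* [DeligneHodgeII1971] P. Deligne, *Théorie de Hodge II*, Publ. Math. IHÉS 40 (1971) — 2.1, 2.1.13–2.1.15.

## Provenance
Lane `lit-hodgefound` (Hodge path, Track 2), prover seat `lit-hodgefound-p21` (generation 39), self-proposed row g39-#7 (sequel of g39-#1–#6 and g27-#1).
-/

noncomputable section

open scoped TensorProduct
open CategoryTheory MonoidalCategory Module Finset
open Literature.AlgebraicTopology.SingularHomology
open Literature.Geometry.Kaehler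

namespace Literature.AlgebraicGeometry.HodgeTheory

open Literature.AlgebraicGeometry.Motives
open Literature.AlgebraicGeometry.Motives.HodgeStructure

variable {m n d : ℕ} {Y Z : SchemeOver ℂ}

/-- `Hom_HS(H₁, H₂)` is finite-dimensional for finite-dimensional carriers. [folklore] -/
private theorem homFinite₇ {V : Type} [AddCommGroup V] [Module ℚ V] {W : Type} [AddCommGroup W] [Module ℚ W] [Module.Finite ℚ V] [Module.Finite ℚ W] {w : ℤ}
    (H₁ : HodgeStructure V w) (H₂ : HodgeStructure W w) : Module.Finite ℚ (Hom H₁ H₂) :=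
  Module.Finite.of_injective ({ toFun := Hom.toLinearMap, map_add' := fun _ _ ↦ rfl, map_smul' := fun _ _ ↦ rfl } : Hom H₁ H₂ →ₗ[ℚ] (V →ₗ[ℚ] W))
    Hom.toLinearMap_injective

section OddPieces

/-- **The top odd `Hom_HS` governs ALL odd degrees, also above the middle: `Hom_HS(H^{mₒ}(Y), H^{nₒ}(Z)(s)) = 0` ⟹ `Hom_HS(Hⁱ(Y), Hʲ(Z)(s')) = 0` for every odd `i` and every `j`, `s'` with
`j − 2s' = i`** (`mₒ ≤ m ≤ mₒ + 1`, `nₒ ≤ n ≤ nₒ + 1` odd): every admissible block `(Pⁱ'(Y), Pʲ'(Z))` of the latter has `i' ≤ m`, `j' ≤ n` odd and is a block of the former. [cite: VoisinHodgeI2002,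
§6.2.3 Thm. 6.25, Cor. 6.26, Rem. 6.27 and §7.3.1 Lemma 7.23, Lemma 7.26] [cite: DeligneHodgeII1971, 2.1, 2.1.13–2.1.14] -/
theorem BettiUniverse.subsingleton_hom_hodge_tateTwist_odd_of_top (hHD : exists_isReal_hodgeModel) (hY : IsSmoothProjective m Y) (hZ : IsSmoothProjective n Z) {mₒ nₒ : ℕ}
    (hmₒ : Odd mₒ) (hmₒm : mₒ ≤ m) (hmmₒ : m ≤ mₒ + 1) (hnₒ : Odd nₒ) (hnₒn : nₒ ≤ n) (hnnₒ : n ≤ nₒ + 1) {s : ℤ} (hs : (nₒ : ℤ) - 2 * s = mₒ)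
    (h : Subsingleton (Hom (BettiUniverse.hodge hHD hY mₒ) (((BettiUniverse.hodge hHD hZ nₒ).tateTwist s).cast hs))) {i j : ℕ} (hi : Odd i) {s' : ℤ}
    (hs' : (j : ℤ) - 2 * s' = i) : Subsingleton (Hom (BettiUniverse.hodge hHD hY i) (((BettiUniverse.hodge hHD hZ j).tateTwist s').cast hs')) := by
  obtain ⟨DY⟩ := nonempty_kaehlerRationalDatum hY
  obtain ⟨DZ⟩ := nonempty_kaehlerRationalDatum hZ
  rw [BettiUniverse.subsingleton_hom_hodge_tateTwist_iff_primitiveHodge hHD hY hZ DY DZ i j hs']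
  intro p q hp hq
  have hp2 := p.2
  have hq2 := q.2
  obtain ⟨k, hk⟩ := hi
  obtain ⟨c, hc⟩ : ∃ c : ℕ, p.1.1 + q.1.1 = 2 * c := ⟨(p.1.1 + q.1.1) / 2, by omega⟩
  exact (subsingleton_hom_twistCast_right_congr _ _ (by omega) _ _).1
    (BettiUniverse.subsingleton_hom_primitiveHodge_odd_of_subsingleton_hom_hodge_top hHD hY hZ DY DZ hmₒ hmₒm hmmₒ hnₒ hnₒn hnnₒ hs h hc ⟨k - p.1.2, by omega⟩
      (by omega) (by omega))

variable [HodgeTensorFacts.{0, 0}]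

/-- Hence **the odd Künneth pieces carry no Hodge classes: `dim_ℚ Hdgᵖ(Hⁱ(Y) ⊗ Hʲ(Z)) = 0` for `i` odd, `i + j = 2p`** (Lemma 11.41: the Hodge classes of the piece are the morphisms
`Hⁱ(Y)^∨ ≅ Hⁱ(Y)(i) → Hʲ(Z)`, i.e. `Hom_HS(HⁱY, HʲZ(p − i))`). [cite: VoisinHodgeI2002, §6.2.3 Cor. 6.26, Rem. 6.27, §7.3.1 Lemma 7.23 and §11.3.3 Lemma 11.41 (p. 286)] [cite: DeligneHodgeII1971, 2.1.13] -/
theorem BettiUniverse.finrank_hodgeClasses_tensor_hodge_eq_zero_of_odd_of_top (hHD : exists_isReal_hodgeModel) (hY : IsSmoothProjective m Y) (hZ : IsSmoothProjective n Z)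
    {mₒ nₒ : ℕ} (hmₒ : Odd mₒ) (hmₒm : mₒ ≤ m) (hmmₒ : m ≤ mₒ + 1) (hnₒ : Odd nₒ) (hnₒn : nₒ ≤ n) (hnnₒ : n ≤ nₒ + 1) {s : ℤ} (hs : (nₒ : ℤ) - 2 * s = mₒ)
    (h : Subsingleton (Hom (BettiUniverse.hodge hHD hY mₒ) (((BettiUniverse.hodge hHD hZ nₒ).tateTwist s).cast hs))) {i j p : ℕ} (hij : i + j = 2 * p) (hi : Odd i) :
    Module.finrank ℚ ↥(((BettiUniverse.hodge hHD hY i).tensor (BettiUniverse.hodge hHD hZ j)).hodgeClasses p) = 0 := by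
  haveI := BettiUniverse.finite hY i
  haveI := BettiUniverse.finite hZ j
  have e := BettiUniverse.finrank_hodgeClasses_tensor_hodge_eq_finrank_hom_tateTwist hHD hY hZ i j (s := (p : ℤ) - i) (by omega)
  rw [show ((i : ℤ) + ((p : ℤ) - i)) = (p : ℤ) by ring] at e
  rw [e]
  haveI := homFinite₇ (BettiUniverse.hodge hHD hY i) (((BettiUniverse.hodge hHD hZ j).tateTwist ((p : ℤ) - i)).cast (by omega))
  exact Module.finrank_zero_iff.2 (BettiUniverse.subsingleton_hom_hodge_tateTwist_odd_of_top hHD hY hZ hmₒ hmₒm hmmₒ hnₒ hnₒn hnnₒ hs h hi _)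

end OddPieces

section EvenPieces

/-- Blockwise: under the top even count, **`dim Hom_HS(Pⁱ(Y), Pʲ(Z)(σ)) = dim Hdg^{a−t}(Pⁱ(Y)) · dim Hdg^{b−t'}(Pʲ(Z))`** for every admissible block `i + 2t = 2a`, `j + 2t' = 2b`, `i + t ≤ m`,
`j + t' ≤ n` (`j − 2σ = i`; `i = 2a'` with `a' ≤ μ`, and g39-#5's block equality). [cite: VoisinHodgeI2002, §6.2.3 Cor. 6.26, Rem. 6.27, §7.3.1 Lemma 7.23, Lemma 7.26 and §11.3.3 Lemma 11.41]
[cite: HulekLaface2019PicardNumbersAV, §2.1 Prop. 2.2] -/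
theorem BettiUniverse.finrank_hom_primitiveHodge_eq_mul_of_top (hHD : exists_isReal_hodgeModel) (hY : IsSmoothProjective m Y) (hZ : IsSmoothProjective n Z)
    (DY : KaehlerRationalDatum m Y) (DZ : KaehlerRationalDatum n Z) {μ ν : ℕ} (hμ : 2 * μ ≤ m) (hmμ : m ≤ 2 * μ + 1) (hν : 2 * ν ≤ n) (hnν : n ≤ 2 * ν + 1) {s' : ℤ}
    (hs' : ((2 * ν : ℕ) : ℤ) - 2 * s' = ((2 * μ : ℕ) : ℤ))
    (h : Module.finrank ℚ (Hom (BettiUniverse.hodge hHD hY (2 * μ)) (((BettiUniverse.hodge hHD hZ (2 * ν)).tateTwist s').cast hs')) ≤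
      Module.finrank ℚ ↥((BettiUniverse.hodge hHD hY (2 * μ)).hodgeClasses μ) * Module.finrank ℚ ↥((BettiUniverse.hodge hHD hZ (2 * ν)).hodgeClasses ν))
    {i t j t' a b : ℕ} (hi : i + 2 * t = 2 * a) (hj : j + 2 * t' = 2 * b) (him : i + t ≤ m) (hjn : j + t' ≤ n) {σ : ℤ} (hσ : (j : ℤ) - 2 * σ = i) :
    Module.finrank ℚ (Hom (BettiUniverse.primitiveHodge hHD hY DY i) (((BettiUniverse.primitiveHodge hHD hZ DZ j).tateTwist σ).cast hσ)) =
      Module.finrank ℚ ↥((BettiUniverse.primitiveHodge hHD hY DY i).hodgeClasses ((a : ℤ) - t)) *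
        Module.finrank ℚ ↥((BettiUniverse.primitiveHodge hHD hZ DZ j).hodgeClasses ((b : ℤ) - t')) := by
  obtain ⟨a', rfl⟩ : ∃ a', i = 2 * a' := ⟨a - t, by omega⟩
  obtain ⟨b', rfl⟩ : ∃ b', j = 2 * b' := ⟨b - t', by omega⟩
  have e := BettiUniverse.finrank_hom_primitiveHodge_eq_mul_of_finrank_hom_hodge_le hHD hY hZ DY DZ hμ hν hs' h (a := a') (b := b') (by omega) (by omega)
  rw [show (a : ℤ) - t = a' by omega, show (b : ℤ) - t' = b' by omega, ← e]
  exact finrank_hom_twistCast_right_congr _ _ (by push_cast at hσ ⊢; omega) _ _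

/-- **The top even count governs ALL even degrees, also above the middle: `dim Hom_HS(H^{2μ}(Y), H^{2ν}(Z)(ν − μ)) ≤ ρ_μ(Y) ρ_ν(Z)` ⟹ `dim Hom_HS(H^{2a}(Y), H^{2b}(Z)(s)) = ρ_a(Y) ρ_b(Z)`
for every `a`, `b`** (`2b − 2s = 2a`; `2μ ≤ m ≤ 2μ + 1`, `2ν ≤ n ≤ 2ν + 1`): both sides are sums over the admissible blocks `a' ≤ μ`, `b' ≤ ν`, blockwise equal. [cite: VoisinHodgeI2002, §6.2.3
Thm. 6.25, Cor. 6.26, Rem. 6.27, §7.3.1 Lemma 7.23, Lemma 7.26 and §11.3.3 Lemma 11.41, p. 287] [cite: HulekLaface2019PicardNumbersAV, §2.1 Prop. 2.2] -/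
theorem BettiUniverse.finrank_hom_hodge_tateTwist_even_eq_mul_of_top (hHD : exists_isReal_hodgeModel) (hY : IsSmoothProjective m Y) (hZ : IsSmoothProjective n Z) {μ ν : ℕ}
    (hμ : 2 * μ ≤ m) (hmμ : m ≤ 2 * μ + 1) (hν : 2 * ν ≤ n) (hnν : n ≤ 2 * ν + 1) {s' : ℤ} (hs' : ((2 * ν : ℕ) : ℤ) - 2 * s' = ((2 * μ : ℕ) : ℤ))
    (h : Module.finrank ℚ (Hom (BettiUniverse.hodge hHD hY (2 * μ)) (((BettiUniverse.hodge hHD hZ (2 * ν)).tateTwist s').cast hs')) ≤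
      Module.finrank ℚ ↥((BettiUniverse.hodge hHD hY (2 * μ)).hodgeClasses μ) * Module.finrank ℚ ↥((BettiUniverse.hodge hHD hZ (2 * ν)).hodgeClasses ν))
    (a b : ℕ) {s : ℤ} (hs : ((2 * b : ℕ) : ℤ) - 2 * s = ((2 * a : ℕ) : ℤ)) :
    Module.finrank ℚ (Hom (BettiUniverse.hodge hHD hY (2 * a)) (((BettiUniverse.hodge hHD hZ (2 * b)).tateTwist s).cast hs)) =
      Module.finrank ℚ ↥((BettiUniverse.hodge hHD hY (2 * a)).hodgeClasses a) * Module.finrank ℚ ↥((BettiUniverse.hodge hHD hZ (2 * b)).hodgeClasses b) := by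
  obtain ⟨DY⟩ := nonempty_kaehlerRationalDatum hY
  obtain ⟨DZ⟩ := nonempty_kaehlerRationalDatum hZ
  rw [BettiUniverse.finrank_hom_hodge_tateTwist_eq_sum_sum_primitiveHodge hHD hY hZ DY DZ (2 * a) (2 * b) hs,
    BettiUniverse.finrank_hodgeClasses_hodge_eq_sum_primitiveHodge hHD hY DY (2 * a) (a : ℤ), BettiUniverse.finrank_hodgeClasses_hodge_eq_sum_primitiveHodge hHD hZ DZ (2 * b) (b : ℤ),
    Finset.sum_mul_sum]
  refine Finset.sum_congr rfl fun p _ ↦ Finset.sum_congr rfl fun q _ ↦ ?_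
  have hp2 := p.2
  have hq2 := q.2
  by_cases hp : p.1.1 + p.1.2 ≤ m
  · by_cases hq : q.1.1 + q.1.2 ≤ n
    · rw [if_pos ⟨hp, hq⟩, if_pos hp, if_pos hq]
      exact BettiUniverse.finrank_hom_primitiveHodge_eq_mul_of_top hHD hY hZ DY DZ hμ hmμ hν hnν hs' h hp2 hq2 hp hq _
    · rw [if_neg fun h ↦ hq h.2, if_neg hq, mul_zero]
  · rw [if_neg fun h ↦ hp h.1, if_neg hp, zero_mul]

variable [HodgeTensorFacts.{0, 0}]

/-- Hence **every even Künneth piece carries exactly the products of Hodge classes: `dim_ℚ Hdgᵖ(H^{2a}(Y) ⊗ H^{2b}(Z)) = ρ_a(Y) ρ_b(Z)` for `a + b = p`** under the top even count.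
[cite: VoisinHodgeI2002, §6.2.3 Cor. 6.26, Rem. 6.27, §7.3.1 Lemma 7.23 and §11.3.3 Thm. 11.38, Lemma 11.41, p. 287] [cite: HulekLaface2019PicardNumbersAV, §2.1 Prop. 2.2] -/
theorem BettiUniverse.finrank_hodgeClasses_tensor_hodge_even_eq_mul_of_top (hHD : exists_isReal_hodgeModel) (hY : IsSmoothProjective m Y) (hZ : IsSmoothProjective n Z) {μ ν : ℕ}
    (hμ : 2 * μ ≤ m) (hmμ : m ≤ 2 * μ + 1) (hν : 2 * ν ≤ n) (hnν : n ≤ 2 * ν + 1) {s' : ℤ} (hs' : ((2 * ν : ℕ) : ℤ) - 2 * s' = ((2 * μ : ℕ) : ℤ))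
    (h : Module.finrank ℚ (Hom (BettiUniverse.hodge hHD hY (2 * μ)) (((BettiUniverse.hodge hHD hZ (2 * ν)).tateTwist s').cast hs')) ≤
      Module.finrank ℚ ↥((BettiUniverse.hodge hHD hY (2 * μ)).hodgeClasses μ) * Module.finrank ℚ ↥((BettiUniverse.hodge hHD hZ (2 * ν)).hodgeClasses ν))
    {a b p : ℕ} (hp : a + b = p) :
    Module.finrank ℚ ↥(((BettiUniverse.hodge hHD hY (2 * a)).tensor (BettiUniverse.hodge hHD hZ (2 * b))).hodgeClasses p) =
      Module.finrank ℚ ↥((BettiUniverse.hodge hHD hY (2 * a)).hodgeClasses a) * Module.finrank ℚ ↥((BettiUniverse.hodge hHD hZ (2 * b)).hodgeClasses b) := by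
  have e := BettiUniverse.finrank_hodgeClasses_tensor_hodge_eq_finrank_hom_tateTwist hHD hY hZ (2 * a) (2 * b) (s := (b : ℤ) - a) (by push_cast; ring)
  rw [show (((2 * a : ℕ) : ℤ) + ((b : ℤ) - a)) = (p : ℤ) by push_cast; omega] at e
  rw [e]
  exact BettiUniverse.finrank_hom_hodge_tateTwist_even_eq_mul_of_top hHD hY hZ hμ hmμ hν hnν hs' h a b _

end EvenPieces

section GlobalCount

/-- The doubled antidiagonal of `p` lies in the antidiagonal of `2p`. [folklore] -/
private theorem image_double_antidiagonal_subset (p : ℕ) :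
    (antidiagonal p).image (fun ab : ℕ × ℕ ↦ (2 * ab.1, 2 * ab.2)) ⊆ antidiagonal (2 * p) := by
  intro x hx
  obtain ⟨ab, hab, rfl⟩ := Finset.mem_image.1 hx
  rw [HasAntidiagonal.mem_antidiagonal] at hab ⊢
  dsimp only
  omega

/-- Doubling is injective on index pairs. [folklore] -/
private theorem double_injOn (S : Finset (ℕ × ℕ)) : Set.InjOn (fun ab : ℕ × ℕ ↦ (2 * ab.1, 2 * ab.2)) ↑S := by
  intro x _ y _ hxy
  simp only [Prod.mk.injEq] at hxy
  exact Prod.ext (by omega) (by omega)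

/-- A pair `(i, j)` with `i + j = 2p` outside the doubled antidiagonal has `i` odd. [folklore] -/
private theorem odd_of_not_mem_image_double {p : ℕ} {ij : ℕ × ℕ} (hij : ij ∈ antidiagonal (2 * p))
    (h : ij ∉ (antidiagonal p).image (fun ab : ℕ × ℕ ↦ (2 * ab.1, 2 * ab.2))) : Odd ij.1 := by
  rw [HasAntidiagonal.mem_antidiagonal] at hij
  rcases Nat.even_or_odd' ij.1 with ⟨k, hk | hk⟩
  · exfalso
    refine h (Finset.mem_image.2 ⟨(k, p - k), HasAntidiagonal.mem_antidiagonal.2 (by dsimp only; omega), ?_⟩)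
    exact Prod.ext (by dsimp only; omega) (by dsimp only; omega)
  · exact ⟨k, hk⟩

/-- **THE TWO TOP-DEGREE CONDITIONS ⟹ NO EXCEPTIONAL HODGE CLASSES: `dim_ℚ Hdgᵖ(H^{2p}(Y × Z)) = Σ_{a+b=p} ρ_a(Y) ρ_b(Z)` for every `p`** (any smooth-projective structure `hYZ` on the
product; `Hom_HS(H^{mₒ}Y, H^{nₒ}Z(s)) = 0` for the top odd degrees and `dim Hom_HS(H^{2μ}Y, H^{2ν}Z(s')) ≤ ρ_μ(Y)ρ_ν(Z)` for the top even degrees): Künneth (Thm. 11.38/11.40) splits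
`Hdgᵖ(H^{2p}(Y × Z))` over the pieces `Hⁱ(Y) ⊗ Hʲ(Z)`, `i + j = 2p`; the odd pieces are Hodge-free (§1) and the even pieces carry `ρ_{i/2}(Y) ρ_{j/2}(Z)` classes (§2) — this is the hypothesis of
g27-#1's criterion `BettiUniverse.hodgeConjectureFor_tensor_of_forall_finrank_eq_sum` (so g39-#5's criterion factors through it). [cite: VoisinHodgeI2002, §6.2.3 Cor. 6.26, Rem. 6.27, §7.3.1
Lemma 7.23, Lemma 7.26, §11.3.3 Thm. 11.38–11.40, Lemma 11.41, p. 287] [cite: Arapura2001HodgeCyclesModuli, Lemma 9 and Cor. 10] [cite: HulekLaface2019PicardNumbersAV, §2.1 Prop. 2.2] -/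
theorem BettiUniverse.finrank_hodgeClasses_hodge_tensor_eq_sum_mul_of_top (hHD : exists_isReal_hodgeModel) (hY : IsSmoothProjective m Y) (hZ : IsSmoothProjective n Z)
    (hYZ : IsSmoothProjective d (Y ⊗ Z)) {mₒ nₒ : ℕ} (hmₒ : Odd mₒ) (hmₒm : mₒ ≤ m) (hmmₒ : m ≤ mₒ + 1) (hnₒ : Odd nₒ) (hnₒn : nₒ ≤ n) (hnnₒ : n ≤ nₒ + 1) {s : ℤ}
    (hs : (nₒ : ℤ) - 2 * s = mₒ) (hodd : Subsingleton (Hom (BettiUniverse.hodge hHD hY mₒ) (((BettiUniverse.hodge hHD hZ nₒ).tateTwist s).cast hs))) {μ ν : ℕ}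
    (hμ : 2 * μ ≤ m) (hmμ : m ≤ 2 * μ + 1) (hν : 2 * ν ≤ n) (hnν : n ≤ 2 * ν + 1) {s' : ℤ} (hs' : ((2 * ν : ℕ) : ℤ) - 2 * s' = ((2 * μ : ℕ) : ℤ))
    (heven : Module.finrank ℚ (Hom (BettiUniverse.hodge hHD hY (2 * μ)) (((BettiUniverse.hodge hHD hZ (2 * ν)).tateTwist s').cast hs')) ≤
      Module.finrank ℚ ↥((BettiUniverse.hodge hHD hY (2 * μ)).hodgeClasses μ) * Module.finrank ℚ ↥((BettiUniverse.hodge hHD hZ (2 * ν)).hodgeClasses ν)) (p : ℕ) :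
    Module.finrank ℚ ↥((BettiUniverse.hodge hHD hYZ (2 * p)).hodgeClasses p) =
      ∑ ab ∈ antidiagonal p, Module.finrank ℚ ↥((BettiUniverse.hodge hHD hY (2 * ab.1)).hodgeClasses ab.1) *
        Module.finrank ℚ ↥((BettiUniverse.hodge hHD hZ (2 * ab.2)).hodgeClasses ab.2) := by
  haveI : HodgeTensorFacts.{0, 0} := hodgeTensorFacts_holds
  rw [BettiUniverse.finrank_hodgeClasses_hodge_tensor_eq_sum' hHD hY hZ hYZ (2 * p) p]
  set F : ℕ × ℕ → ℕ := fun ij ↦ Module.finrank ℚ ↥(((BettiUniverse.hodge hHD hY ij.1).tensor (BettiUniverse.hodge hHD hZ ij.2)).hodgeClasses p) with hF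
  calc ∑ ij ∈ antidiagonal (2 * p), F ij
      = ∑ ij ∈ (antidiagonal p).image (fun ab : ℕ × ℕ ↦ (2 * ab.1, 2 * ab.2)), F ij :=
        (Finset.sum_subset (image_double_antidiagonal_subset p) fun ij hij hn ↦
          BettiUniverse.finrank_hodgeClasses_tensor_hodge_eq_zero_of_odd_of_top hHD hY hZ hmₒ hmₒm hmmₒ hnₒ hnₒn hnnₒ hs hodd (HasAntidiagonal.mem_antidiagonal.1 hij)
            (odd_of_not_mem_image_double hij hn)).symm
    _ = ∑ ab ∈ antidiagonal p, F (2 * ab.1, 2 * ab.2) := Finset.sum_image (double_injOn _)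
    _ = _ := Finset.sum_congr rfl fun ab hab ↦
        BettiUniverse.finrank_hodgeClasses_tensor_hodge_even_eq_mul_of_top hHD hY hZ hμ hmμ hν hnν hs' heven (HasAntidiagonal.mem_antidiagonal.1 hab)

end GlobalCount

section Converse

/-- The Künneth count splits into the doubled antidiagonal and the rest, and the doubled part dominates the product count. [cite: VoisinHodgeI2002, §11.3.3 Thm. 11.38 and Thm. 11.40 (p. 285)] -/
private theorem sum_split_double [HodgeTensorFacts.{0, 0}] (hHD : exists_isReal_hodgeModel) (hY : IsSmoothProjective m Y) (hZ : IsSmoothProjective n Z) (p : ℕ) :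
    ∑ ij ∈ antidiagonal (2 * p), Module.finrank ℚ ↥(((BettiUniverse.hodge hHD hY ij.1).tensor (BettiUniverse.hodge hHD hZ ij.2)).hodgeClasses p) =
      ∑ ab ∈ antidiagonal p, Module.finrank ℚ ↥(((BettiUniverse.hodge hHD hY (2 * ab.1)).tensor (BettiUniverse.hodge hHD hZ (2 * ab.2))).hodgeClasses p) +
        ∑ ij ∈ antidiagonal (2 * p) \ (antidiagonal p).image (fun ab : ℕ × ℕ ↦ (2 * ab.1, 2 * ab.2)),
          Module.finrank ℚ ↥(((BettiUniverse.hodge hHD hY ij.1).tensor (BettiUniverse.hodge hHD hZ ij.2)).hodgeClasses p) ∧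
    ∑ ab ∈ antidiagonal p, Module.finrank ℚ ↥((BettiUniverse.hodge hHD hY (2 * ab.1)).hodgeClasses ab.1) *
        Module.finrank ℚ ↥((BettiUniverse.hodge hHD hZ (2 * ab.2)).hodgeClasses ab.2) ≤
      ∑ ab ∈ antidiagonal p, Module.finrank ℚ ↥(((BettiUniverse.hodge hHD hY (2 * ab.1)).tensor (BettiUniverse.hodge hHD hZ (2 * ab.2))).hodgeClasses p) := by
  classical
  haveI := fun k ↦ BettiUniverse.finite hY k
  haveI := fun k ↦ BettiUniverse.finite hZ k
  set F : ℕ × ℕ → ℕ := fun ij ↦ Module.finrank ℚ ↥(((BettiUniverse.hodge hHD hY ij.1).tensor (BettiUniverse.hodge hHD hZ ij.2)).hodgeClasses p) with hF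
  refine ⟨?_, Finset.sum_le_sum fun ab hab ↦ ?_⟩
  · have himg : ∑ ij ∈ (antidiagonal p).image (fun ab : ℕ × ℕ ↦ (2 * ab.1, 2 * ab.2)), F ij = ∑ ab ∈ antidiagonal p, F (2 * ab.1, 2 * ab.2) :=
      Finset.sum_image (double_injOn _)
    rw [← Finset.sum_sdiff (image_double_antidiagonal_subset p), himg, add_comm]
  · have h := HodgeStructure.finrank_hodgeClasses_mul_le_finrank_hodgeClasses_tensor (BettiUniverse.hodge hHD hY (2 * ab.1)) (BettiUniverse.hodge hHD hZ (2 * ab.2)) (ab.1 : ℤ) (ab.2 : ℤ)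
    rw [show ((ab.1 : ℤ) + (ab.2 : ℤ)) = (p : ℤ) by have := HasAntidiagonal.mem_antidiagonal.1 hab; omega] at h
    exact h

/-- **NO EXCEPTIONAL HODGE CLASSES ⟹ the odd Künneth pieces are Hodge-free**: if `dim Hdgᵖ(H^{2p}(Y × Z)) = Σ_{a+b=p} ρ_a(Y)ρ_b(Z)` for all `p`, then `dim Hdgᵖ(Hⁱ(Y) ⊗ Hʲ(Z)) = 0` for `i` odd,
`i + j = 2p` (the total equals its subsum over the even pieces, each of which is already `≥ ρ_aρ_b`, Thm. 11.38). [cite: VoisinHodgeI2002, §11.3.3 Thm. 11.38, Thm. 11.40 (p. 285) and p. 287]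
[cite: Arapura2001HodgeCyclesModuli, Lemma 9] -/
theorem BettiUniverse.finrank_hodgeClasses_tensor_hodge_eq_zero_of_forall_eq_sum_mul [HodgeTensorFacts.{0, 0}] (hHD : exists_isReal_hodgeModel) (hY : IsSmoothProjective m Y)
    (hZ : IsSmoothProjective n Z) (hYZ : IsSmoothProjective d (Y ⊗ Z))
    (hsum : ∀ p : ℕ, Module.finrank ℚ ↥((BettiUniverse.hodge hHD hYZ (2 * p)).hodgeClasses p) =
      ∑ ab ∈ antidiagonal p, Module.finrank ℚ ↥((BettiUniverse.hodge hHD hY (2 * ab.1)).hodgeClasses ab.1) *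
        Module.finrank ℚ ↥((BettiUniverse.hodge hHD hZ (2 * ab.2)).hodgeClasses ab.2))
    {i j p : ℕ} (hij : i + j = 2 * p) (hi : Odd i) :
    Module.finrank ℚ ↥(((BettiUniverse.hodge hHD hY i).tensor (BettiUniverse.hodge hHD hZ j)).hodgeClasses p) = 0 := by
  classical
  obtain ⟨htot, hle⟩ := sum_split_double hHD hY hZ p
  have h2 := hsum p
  rw [BettiUniverse.finrank_hodgeClasses_hodge_tensor_eq_sum' hHD hY hZ hYZ (2 * p) p, htot] at h2
  -- so the odd part of the sum vanishes
  have hzero : ∑ ij ∈ antidiagonal (2 * p) \ (antidiagonal p).image (fun ab : ℕ × ℕ ↦ (2 * ab.1, 2 * ab.2)),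
      Module.finrank ℚ ↥(((BettiUniverse.hodge hHD hY ij.1).tensor (BettiUniverse.hodge hHD hZ ij.2)).hodgeClasses p) = 0 := by omega
  have hmem : (i, j) ∈ antidiagonal (2 * p) \ (antidiagonal p).image (fun ab : ℕ × ℕ ↦ (2 * ab.1, 2 * ab.2)) := by
    refine Finset.mem_sdiff.2 ⟨HasAntidiagonal.mem_antidiagonal.2 hij, fun h ↦ ?_⟩
    obtain ⟨ab, _, hab⟩ := Finset.mem_image.1 h
    rw [Prod.mk.injEq] at hab
    obtain ⟨k, hk⟩ := hi
    omega
  exact Finset.sum_eq_zero_iff.1 hzero (i, j) hmem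

/-- … hence **`Hom_HS(Hⁱ(Y), Hʲ(Z)(s)) = 0` for `i` odd and every `j − 2s = i`** (Lemma 11.41). [cite: VoisinHodgeI2002, §11.3.3 Thm. 11.38, Lemma 11.41 (p. 286) and p. 287] -/
theorem BettiUniverse.subsingleton_hom_hodge_tateTwist_of_forall_eq_sum_mul (hHD : exists_isReal_hodgeModel) (hY : IsSmoothProjective m Y) (hZ : IsSmoothProjective n Z)
    (hYZ : IsSmoothProjective d (Y ⊗ Z))
    (hsum : ∀ p : ℕ, Module.finrank ℚ ↥((BettiUniverse.hodge hHD hYZ (2 * p)).hodgeClasses p) =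
      ∑ ab ∈ antidiagonal p, Module.finrank ℚ ↥((BettiUniverse.hodge hHD hY (2 * ab.1)).hodgeClasses ab.1) *
        Module.finrank ℚ ↥((BettiUniverse.hodge hHD hZ (2 * ab.2)).hodgeClasses ab.2))
    {i j : ℕ} (hi : Odd i) {s : ℤ} (hs : (j : ℤ) - 2 * s = i) :
    Subsingleton (Hom (BettiUniverse.hodge hHD hY i) (((BettiUniverse.hodge hHD hZ j).tateTwist s).cast hs)) := by
  haveI : HodgeTensorFacts.{0, 0} := hodgeTensorFacts_holds
  haveI := BettiUniverse.finite hY i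
  haveI := BettiUniverse.finite hZ j
  haveI := homFinite₇ (BettiUniverse.hodge hHD hY i) (((BettiUniverse.hodge hHD hZ j).tateTwist s).cast hs)
  obtain ⟨k, hk⟩ := hi
  obtain ⟨p, hp⟩ : ∃ p : ℕ, i + j = 2 * p := ⟨(i + j) / 2, by omega⟩
  rw [← Module.finrank_zero_iff (R := ℚ), ← BettiUniverse.finrank_hodgeClasses_tensor_hodge_eq_finrank_hom_tateTwist hHD hY hZ i j hs,
    show ((i : ℤ) + s) = ((p : ℕ) : ℤ) by omega]
  exact BettiUniverse.finrank_hodgeClasses_tensor_hodge_eq_zero_of_forall_eq_sum_mul hHD hY hZ hYZ hsum hp ⟨k, hk⟩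

/-- **NO EXCEPTIONAL HODGE CLASSES ⟹ every even piece is saturated: `dim Hom_HS(H^{2a}(Y), H^{2b}(Z)(s)) = ρ_a(Y) ρ_b(Z)`** (`2b − 2s = 2a`) for all `a`, `b`. [cite: VoisinHodgeI2002, §11.3.3
Thm. 11.38, Thm. 11.40, Lemma 11.41 and p. 287] [cite: Arapura2001HodgeCyclesModuli, Lemma 9] [cite: HulekLaface2019PicardNumbersAV, §2.1 Prop. 2.2] -/
theorem BettiUniverse.finrank_hom_hodge_tateTwist_eq_mul_of_forall_eq_sum_mul (hHD : exists_isReal_hodgeModel) (hY : IsSmoothProjective m Y) (hZ : IsSmoothProjective n Z)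
    (hYZ : IsSmoothProjective d (Y ⊗ Z))
    (hsum : ∀ p : ℕ, Module.finrank ℚ ↥((BettiUniverse.hodge hHD hYZ (2 * p)).hodgeClasses p) =
      ∑ ab ∈ antidiagonal p, Module.finrank ℚ ↥((BettiUniverse.hodge hHD hY (2 * ab.1)).hodgeClasses ab.1) *
        Module.finrank ℚ ↥((BettiUniverse.hodge hHD hZ (2 * ab.2)).hodgeClasses ab.2))
    (a b : ℕ) {s : ℤ} (hs : ((2 * b : ℕ) : ℤ) - 2 * s = ((2 * a : ℕ) : ℤ)) :
    Module.finrank ℚ (Hom (BettiUniverse.hodge hHD hY (2 * a)) (((BettiUniverse.hodge hHD hZ (2 * b)).tateTwist s).cast hs)) =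
      Module.finrank ℚ ↥((BettiUniverse.hodge hHD hY (2 * a)).hodgeClasses a) * Module.finrank ℚ ↥((BettiUniverse.hodge hHD hZ (2 * b)).hodgeClasses b) := by
  classical
  haveI : HodgeTensorFacts.{0, 0} := hodgeTensorFacts_holds
  haveI := fun k ↦ BettiUniverse.finite hY k
  haveI := fun k ↦ BettiUniverse.finite hZ k
  obtain ⟨htot, hle⟩ := sum_split_double hHD hY hZ (a + b)
  have h2 := hsum (a + b)
  rw [BettiUniverse.finrank_hodgeClasses_hodge_tensor_eq_sum' hHD hY hZ hYZ (2 * (a + b)) (a + b : ℕ), htot] at h2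
  have h3 : ∑ ab ∈ antidiagonal (a + b), Module.finrank ℚ ↥((BettiUniverse.hodge hHD hY (2 * ab.1)).hodgeClasses ab.1) *
        Module.finrank ℚ ↥((BettiUniverse.hodge hHD hZ (2 * ab.2)).hodgeClasses ab.2) =
      ∑ ab ∈ antidiagonal (a + b), Module.finrank ℚ ↥(((BettiUniverse.hodge hHD hY (2 * ab.1)).tensor (BettiUniverse.hodge hHD hZ (2 * ab.2))).hodgeClasses ((a + b : ℕ) : ℤ)) := by
    omega
  have hle' : ∀ ab ∈ antidiagonal (a + b), Module.finrank ℚ ↥((BettiUniverse.hodge hHD hY (2 * ab.1)).hodgeClasses ab.1) *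
        Module.finrank ℚ ↥((BettiUniverse.hodge hHD hZ (2 * ab.2)).hodgeClasses ab.2) ≤
      Module.finrank ℚ ↥(((BettiUniverse.hodge hHD hY (2 * ab.1)).tensor (BettiUniverse.hodge hHD hZ (2 * ab.2))).hodgeClasses ((a + b : ℕ) : ℤ)) := by
    intro ab hab
    have h := HodgeStructure.finrank_hodgeClasses_mul_le_finrank_hodgeClasses_tensor (BettiUniverse.hodge hHD hY (2 * ab.1)) (BettiUniverse.hodge hHD hZ (2 * ab.2)) (ab.1 : ℤ) (ab.2 : ℤ)
    rw [show ((ab.1 : ℤ) + (ab.2 : ℤ)) = ((a + b : ℕ) : ℤ) by have := HasAntidiagonal.mem_antidiagonal.1 hab; omega] at h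
    exact h
  have key := ((Finset.sum_eq_sum_iff_of_le hle').1 h3 (a, b) (HasAntidiagonal.mem_antidiagonal.2 rfl)).symm
  -- `key : dim Hdg^{a+b}(H^{2a}Y ⊗ H^{2b}Z) = ρ_a ρ_b`; convert the piece count into the `Hom` count (Lemma 11.41)
  have e := BettiUniverse.finrank_hodgeClasses_tensor_hodge_eq_finrank_hom_tateTwist hHD hY hZ (2 * a) (2 * b) hs
  rw [show (((2 * a : ℕ) : ℤ) + s) = ((a + b : ℕ) : ℤ) by push_cast at hs ⊢; omega] at e
  rw [← e]
  exact key

end Converse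

section Iff

/-- **THE EQUIVALENCE.**  For smooth projective `Y`, `Z` (top odd degrees `mₒ ≤ m ≤ mₒ + 1`, `nₒ ≤ n ≤ nₒ + 1`, `nₒ − 2s = mₒ`; top even degrees `2μ ≤ m ≤ 2μ + 1`, `2ν ≤ n ≤ 2ν + 1`,
`2ν − 2s' = 2μ`) and any smooth-projective structure on `Y × Z`: **`Y × Z` has no exceptional Hodge classes (`dim_ℚ Hdgᵖ(H^{2p}(Y × Z)) = Σ_{a+b=p} ρ_a(Y)ρ_b(Z)` for all `p`) IFF
`Hom_HS(H^{mₒ}(Y), H^{nₒ}(Z)(s)) = 0` and `dim_ℚ Hom_HS(H^{2μ}(Y), H^{2ν}(Z)(s')) ≤ ρ_μ(Y) ρ_ν(Z)`.** [cite: VoisinHodgeI2002, §6.2.3 Cor. 6.26, Rem. 6.27, §7.3.1 Lemma 7.23, Lemma 7.26,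
§11.3.3 Thm. 11.38–11.40, Lemma 11.41, p. 287] [cite: Arapura2001HodgeCyclesModuli, Lemma 9 and Cor. 10] [cite: HulekLaface2019PicardNumbersAV, §2.1 Prop. 2.2] [cite: DeligneHodgeII1971, 2.1.13] -/
theorem BettiUniverse.forall_finrank_hodgeClasses_eq_sum_mul_iff_top (hHD : exists_isReal_hodgeModel) (hY : IsSmoothProjective m Y) (hZ : IsSmoothProjective n Z)
    (hYZ : IsSmoothProjective d (Y ⊗ Z)) {mₒ nₒ : ℕ} (hmₒ : Odd mₒ) (hmₒm : mₒ ≤ m) (hmmₒ : m ≤ mₒ + 1) (hnₒ : Odd nₒ) (hnₒn : nₒ ≤ n) (hnnₒ : n ≤ nₒ + 1) {s : ℤ}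
    (hs : (nₒ : ℤ) - 2 * s = mₒ) {μ ν : ℕ} (hμ : 2 * μ ≤ m) (hmμ : m ≤ 2 * μ + 1) (hν : 2 * ν ≤ n) (hnν : n ≤ 2 * ν + 1) {s' : ℤ}
    (hs' : ((2 * ν : ℕ) : ℤ) - 2 * s' = ((2 * μ : ℕ) : ℤ)) :
    (∀ p : ℕ, Module.finrank ℚ ↥((BettiUniverse.hodge hHD hYZ (2 * p)).hodgeClasses p) =
      ∑ ab ∈ antidiagonal p, Module.finrank ℚ ↥((BettiUniverse.hodge hHD hY (2 * ab.1)).hodgeClasses ab.1) *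
        Module.finrank ℚ ↥((BettiUniverse.hodge hHD hZ (2 * ab.2)).hodgeClasses ab.2)) ↔
    Subsingleton (Hom (BettiUniverse.hodge hHD hY mₒ) (((BettiUniverse.hodge hHD hZ nₒ).tateTwist s).cast hs)) ∧
      Module.finrank ℚ (Hom (BettiUniverse.hodge hHD hY (2 * μ)) (((BettiUniverse.hodge hHD hZ (2 * ν)).tateTwist s').cast hs')) ≤
        Module.finrank ℚ ↥((BettiUniverse.hodge hHD hY (2 * μ)).hodgeClasses μ) * Module.finrank ℚ ↥((BettiUniverse.hodge hHD hZ (2 * ν)).hodgeClasses ν) :=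
  ⟨fun h ↦ ⟨BettiUniverse.subsingleton_hom_hodge_tateTwist_of_forall_eq_sum_mul hHD hY hZ hYZ h hmₒ hs,
      (BettiUniverse.finrank_hom_hodge_tateTwist_eq_mul_of_forall_eq_sum_mul hHD hY hZ hYZ h μ ν hs').le⟩,
    fun h ↦ BettiUniverse.finrank_hodgeClasses_hodge_tensor_eq_sum_mul_of_top hHD hY hZ hYZ hmₒ hmₒm hmmₒ hnₒ hnₒn hnnₒ hs h.1 hμ hmμ hν hnν hs' h.2⟩

end Iff

end Literature.AlgebraicGeometry.HodgeTheory

end
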